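import Literature.NumberTheory.LFunctions.RiemannXiProofs
import Literature.NumberTheory.LFunctions.LevinsonGammaFactor
import Literature.Analysis.Complex.PolyDerivOperator
import Mathlib.Algebra.Polynomial.Taylor
import Mathlib.Analysis.Calculus.IteratedDeriv.Lemmas
import HarnessLib

/-!
# Conrey 1989, §3: the exact zero detector `η = G(L⁻¹ d/ds) ξ`, `F₁ = η/H`, and `V = Q(−L⁻¹ d/ds) ζ`

Topic `Literature/NumberTheory/LFunctions`. Definitions with bodies and PROVED identities; no named
facts.

J. B. Conrey, *More than two fifths of the zeros of the Riemann zeta function are on the critical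
line*, J. reine angew. Math. **399** (1989), 1–26, §3 ("Beginning of the proof") runs Levinson's
method with the function

  `V(s) = Q(−L⁻¹ d/ds) ζ(s)`  ((26); `L = log T`, `Q` a real polynomial, `Q(0) = 1`,
  `Q(x) + Q(1 − x) = constant`),

whose mollified mean square is the subject of his Theorem 2 (`θ < 4/7`) and of all later work
(Bui–Conrey–Young 2011, Feng 2012, Pratt–Robles–Zaharescu–Zeindler 2020). The zeros are detected by
the *exact* function `η(s) = g ξ(s) + Σ_{n ≥ 1} gₙ L⁻ⁿ ξ⁽ⁿ⁾(s)` ((18)): with `g` real, `g₂ₙ`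
imaginary and `g₂ₙ₊₁` real one has `Re η(½ + it) = g ξ(½ + it)` ((19)), and `η = H·F₁` ((22)),
`H(s) = ½ s(s−1) π^{−s/2} Γ(s/2)` ((4)), where
`F₁ = Σₙ gₙ L⁻ⁿ Σₖ (n choose k)(H⁽ⁿ⁻ᵏ⁾/H) ζ⁽ᵏ⁾` is approximated by `V` through
`H⁽ᵐ⁾/H (s) = (½ log(s/2π))ᵐ (1 + O(1/|t|))` ((23), (29)–(31)); the parity condition on the `gₙ` is
"equivalently `Q(x) + Q(1 − x) = 2g`" ((29)) for `Q(−x) = G(x + ½)`, `G(y) = Σ gₙ yⁿ`.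

The tree's Levinson framework (`Literature.NumberTheory.LFunctions.levinson_criticalLineProportion_ge`)
is built on Conrey's 1983 variant `Literature.NumberTheory.LFunctions.conreyV` (Siegel's exact formula);
this file provides the 1989 objects, so that Theorem 2 can be consumed as printed:

* `conrey89G Q = Q ∘ (½ − X)` — the polynomial `G` (`Q(−x) = G(x + ½)`), with
  `conrey89G_add_comp_neg_X`: `Q + Q∘(1−X) = c ⇒ G + G∘(−X) = c` (Conrey's parity condition,
  for real `Q`: `G − g` is odd);
* `conrey89V Q L s = (Q(−L⁻¹ d/ds) ζ)(s)` — **Conrey's `V`** (DEFINITION, via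
  `Literature.Analysis.Complex.polyDerivOp`);
* `conrey89Eta Q L s = (G(L⁻¹ d/ds) ξ)(s)` — **Conrey's `η`** (DEFINITION; `ξ` is the tree's entire
  `Literature.NumberTheory.LFunctions.riemannXi`), with **`η(s) + conj η(1 − s̄) = c ξ(s)`** for all `s`
  (`conrey89Eta_add_conj`; on the line this is (19));
* `conrey89H s = ½ s(s−1) Γℝ(s)` — **Conrey's `H`** (`ξ = H ζ`, `riemannXi_eq_conrey89H_mul`), and
  `conrey89F Q L = η/H` — **Conrey's `F₁`** (DEFINITIONS), with
  **`Γℝ F₁ + (Γℝ F₁)♯ = c Γℝ ζ`** on `0 < Re s < 1` (`Gammaℝ_mul_conrey89F_add_conj`) — the identity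
  through which the generic detection
  `Literature.NumberTheory.LFunctions.levinsonConrey_zeroDetection_Gammaℝ_mul` applies to `F₁`
  exactly as it does to `conreyV` — and analyticity of `F₁` off `{0, 1}` (`analyticAt_conrey89F`);
* `conrey89W Q L i = G⁽ⁱ⁾(L⁻¹ d/ds) ζ` and the two decompositions
  **`V = Σᵢ (2⁻ⁱ/i!) Wᵢ`** (`conrey89V_eq_sum`, Taylor's formula `G(½ + y) = Σ (2⁻ⁱ/i!) G⁽ⁱ⁾(y)`) and
  **`F₁ = Σᵢ (L⁻ⁱ/i!)(H⁽ⁱ⁾/H) Wᵢ`** on `Re s > 0`, `s ≠ 1` (`conrey89F_eq_sum`, Leibniz's rule), whence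
  **`F₁ − V = Σ_{i ≥ 1} ((L⁻ⁱ H⁽ⁱ⁾/H − 2⁻ⁱ)/i!) Wᵢ`** (`conrey89F_sub_conrey89V`): Conrey's (22)–(31)
  made exact, the coefficients being `O(1/L)` for `t ≍ T` by (23).

Supporting algebra (all [folklore]): coefficients of `p ∘ (−X)` (`coeff_comp_neg_X`; the same lemma
exists for a general ring in `Literature/Computability/AlgebraicComplexity/RealTauKnownCases.lean`,
restated here to avoid a cross-topic import), the Taylor shift `p(X + r) = Σ (rⁱ/i!) p⁽ⁱ⁾`
(`comp_X_add_C_eq_sum_derivative`), `polyDerivOp` as a sum over a range, its linearity in the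
polynomial, `p(−aδ) = (p∘(−X))(aδ)`, and Leibniz's rule
`p(aδ)(HZ) = Σᵢ (aⁱ/i!) H⁽ⁱ⁾ · p⁽ⁱ⁾(aδ) Z` (`polyDerivOp_mul_eq_sum`).

What is NOT here: the estimates (`H'/H = ½ log t + O(1)`, the right edge and disc growth of `F₁`,
the mean-square transfer from `V` to `F₁`) and the assembled inequality `κ ≥ 1 − R⁻¹ log c` for
this `V` — the sequel files; and Theorem 2 itself.

## References

* J. B. Conrey, J. reine angew. Math. 399 (1989), 1–26, §2 (2)–(4), §3 (17)–(31). [Conrey1989]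
* J. B. Conrey, *Zeros of derivatives of Riemann's ξ-function on the critical line*, J. Number
  Theory 16 (1983), 49–74, §4. [Conrey1983]
* E. C. Titchmarsh, *The Theory of the Riemann Zeta-Function*, 2nd ed. (1986), §2.1, §10.28.
  [Titchmarsh1986]
-/

noncomputable section

open Complex Polynomial Set Filter Topology
open scoped Real ComplexConjugate Nat

namespace Literature.NumberTheory.LFunctions

open Literature.Analysis.Complex

/-! ### Polynomial algebra: `p(−X)`, the Taylor shift `p(X + r)`, and `polyDerivOp` as a sum over a range -/

/-- Coefficients of `p(−X)`: `(p ∘ (−X))ₖ = (−1)ᵏ pₖ`. [folklore] -/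
theorem coeff_comp_neg_X (p : ℝ[X]) (k : ℕ) : (p.comp (-X)).coeff k = (-1) ^ k * p.coeff k := by
  induction p using Polynomial.induction_on' with
  | add p q hp hq => simp [hp, hq, mul_add]
  | monomial n a =>
    rw [← C_mul_X_pow_eq_monomial, mul_comp, C_comp, X_pow_comp, neg_pow, coeff_C_mul, coeff_C_mul]
    have : ((-1 : ℝ[X]) ^ n * X ^ n).coeff k = (-1) ^ k * (X ^ n : ℝ[X]).coeff k := by
      rw [show ((-1 : ℝ[X]) ^ n) = C ((-1 : ℝ) ^ n) by simp, coeff_C_mul, coeff_X_pow]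
      split_ifs with h
      · subst h; ring
      · simp
    rw [this]; ring

/-- **Taylor shift**: `p(X + r) = Σᵢ (rⁱ/i!) p⁽ⁱ⁾(X)` (any range of summation beyond `deg p`).
[folklore] -/
theorem comp_X_add_C_eq_sum_derivative (p : ℝ[X]) (r : ℝ) {N : ℕ} (hN : p.natDegree < N) :
    p.comp (X + C r) = ∑ i ∈ Finset.range N, C (r ^ i / i !) * (derivative^[i] p) := by
  ext n
  rw [← taylor_apply, taylor_coeff, finsetSum_coeff]
  have hdeg : (hasseDeriv n p).natDegree < N :=
    lt_of_le_of_lt ((natDegree_hasseDeriv_le p n).trans (Nat.sub_le _ _)) hN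
  rw [eval_eq_sum_range' hdeg]
  refine Finset.sum_congr rfl fun i _ ↦ ?_
  rw [hasseDeriv_coeff, coeff_C_mul, coeff_iterate_derivative, nsmul_eq_mul,
    Nat.descFactorial_eq_factorial_mul_choose, add_comm i n, Nat.choose_symm_add]
  have hi : (i ! : ℝ) ≠ 0 := by exact_mod_cast i.factorial_ne_zero
  push_cast
  field_simp

/-- `polyDerivOp` as a sum over any range containing the support. [folklore] -/
theorem polyDerivOp_eq_sum_range (p : ℝ[X]) {N : ℕ} (hN : p.natDegree < N) (a : ℝ) (F : ℂ → ℂ)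
    (s : ℂ) : polyDerivOp p a F s =
      ∑ k ∈ Finset.range N, (p.coeff k : ℂ) * (a : ℂ) ^ k * iteratedDeriv k F s := by
  rw [polyDerivOp, Polynomial.sum_def]
  refine Finset.sum_subset (fun k hk ↦ ?_) (fun k _ hk ↦ ?_)
  · exact Finset.mem_range.2 (lt_of_le_of_lt (le_natDegree_of_mem_supp k hk) hN)
  · have : p.coeff k = 0 := by simpa [mem_support_iff] using hk
    simp [this]

/-- `polyDerivOp` is homogeneous in the polynomial: `polyDerivOp (C r * p) = r * polyDerivOp p`. [folklore] -/
theorem polyDerivOp_C_mul (r : ℝ) (p : ℝ[X]) (a : ℝ) (F : ℂ → ℂ) (s : ℂ) :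
    polyDerivOp (C r * p) a F s = r * polyDerivOp p a F s := by
  have hN : (C r * p).natDegree < p.natDegree + 1 :=
    lt_of_le_of_lt (natDegree_C_mul_le r p) (Nat.lt_succ_self _)
  rw [polyDerivOp_eq_sum_range _ hN, polyDerivOp_eq_sum_range p (Nat.lt_succ_self _), Finset.mul_sum]
  refine Finset.sum_congr rfl fun k _ ↦ ?_
  rw [coeff_C_mul]; push_cast; ring

/-- `polyDerivOp` of a finite sum of polynomials. [folklore] -/
theorem polyDerivOp_finset_sum_left {ι : Type*} (S : Finset ι) (p : ι → ℝ[X]) (a : ℝ) (F : ℂ → ℂ) (s : ℂ) :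
    polyDerivOp (∑ i ∈ S, p i) a F s = ∑ i ∈ S, polyDerivOp (p i) a F s := by
  classical
  induction S using Finset.induction_on with
  | empty => simp [polyDerivOp_zero]
  | insert i S hi ih => rw [Finset.sum_insert hi, Finset.sum_insert hi, polyDerivOp_add, ih]

/-- Reversing the scale is composing with `−X`: `p(−a δ) = (p ∘ (−X))(a δ)`. [folklore] -/
theorem polyDerivOp_neg (p : ℝ[X]) (a : ℝ) (F : ℂ → ℂ) (s : ℂ) :
    polyDerivOp p (-a) F s = polyDerivOp (p.comp (-X)) a F s := by
  have hN : (p.comp (-X)).natDegree < p.natDegree + 1 := by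
    refine lt_of_le_of_lt (natDegree_comp_le.trans ?_) (Nat.lt_succ_self _)
    simp
  rw [polyDerivOp_eq_sum_range _ hN, polyDerivOp_eq_sum_range p (Nat.lt_succ_self _)]
  refine Finset.sum_congr rfl fun k _ ↦ ?_
  rw [coeff_comp_neg_X]; push_cast; ring

/-- The monomial operator: `polyDerivOp (C c * X^k) a F s = c aᵏ F⁽ᵏ⁾(s)`. [folklore] -/
theorem polyDerivOp_C_mul_X_pow (c a : ℝ) (k : ℕ) (F : ℂ → ℂ) (s : ℂ) :
    polyDerivOp (C c * X ^ k) a F s = c * a ^ k * iteratedDeriv k F s := by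
  have hN : (C c * X ^ k : ℝ[X]).natDegree < k + 1 :=
    lt_of_le_of_lt (natDegree_C_mul_X_pow_le c k) (Nat.lt_succ_self _)
  rw [polyDerivOp_eq_sum_range _ hN, Finset.sum_eq_single k]
  · rw [coeff_C_mul, coeff_X_pow, if_pos rfl, mul_one]
  · intro j _ hj
    rw [coeff_C_mul, coeff_X_pow, if_neg hj]; simp
  · intro h; exact absurd (Finset.mem_range.2 (Nat.lt_succ_self k)) h

/-! ### Leibniz's rule for `polyDerivOp`

`p(aδ)(H·Z) = Σᵢ (aⁱ/i!) H⁽ⁱ⁾ · p⁽ⁱ⁾(aδ)Z` (the symbol calculus `p(D)(fg) = Σ (Dⁱf/i!) p⁽ⁱ⁾(D) g`). -/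

/-- **Leibniz's rule for `p(a d/ds)`**: if `H` and `Z` are `Cⁿ` at `s` for all `n`, then
`(p(aδ)(H·Z))(s) = Σ_{i ≤ deg p} (aⁱ/i!) H⁽ⁱ⁾(s) · (p⁽ⁱ⁾(aδ) Z)(s)`. [folklore] -/
theorem polyDerivOp_mul_eq_sum (p : ℝ[X]) (a : ℝ) {H Z : ℂ → ℂ} {s : ℂ}
    (hH : ∀ n : ℕ, ContDiffAt ℂ n H s) (hZ : ∀ n : ℕ, ContDiffAt ℂ n Z s) {N : ℕ} (hN : p.natDegree < N) :
    polyDerivOp p a (H * Z) s =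
      ∑ i ∈ Finset.range N, (a : ℂ) ^ i / (i ! : ℂ) * iteratedDeriv i H s *
        polyDerivOp (derivative^[i] p) a Z s := by
  -- expand the left side over `range N` and apply Leibniz termwise
  rw [polyDerivOp_eq_sum_range p hN]
  have hL : ∀ k ∈ Finset.range N, (p.coeff k : ℂ) * (a : ℂ) ^ k * iteratedDeriv k (H * Z) s =
      ∑ i ∈ Finset.range N, (if i ≤ k then (p.coeff k : ℂ) * (a : ℂ) ^ k *
        ((k.choose i : ℂ) * iteratedDeriv i H s * iteratedDeriv (k - i) Z s) else 0) := by
    intro k hk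
    rw [iteratedDeriv_mul (hH k) (hZ k), Finset.mul_sum, ← Finset.sum_filter]
    have hkN : k < N := Finset.mem_range.1 hk
    have hfilt : Finset.filter (fun i ↦ i ≤ k) (Finset.range N) = Finset.range (k + 1) := by
      ext i; simp only [Finset.mem_filter, Finset.mem_range]; omega
    rw [hfilt]
  rw [Finset.sum_congr rfl hL, Finset.sum_comm]
  refine Finset.sum_congr rfl fun i hi ↦ ?_
  -- right side, `i` fixed: expand `polyDerivOp (derivative^[i] p)`
  have hNi : (derivative^[i] p).natDegree < N :=
    lt_of_le_of_lt (natDegree_iterate_derivative p i |>.trans (Nat.sub_le _ _)) hN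
  rw [polyDerivOp_eq_sum_range _ hNi, Finset.mul_sum]
  -- reindex the left sum `k ↦ k - i` on `k ≥ i`
  have hiN : i ≤ N := (Finset.mem_range.1 hi).le
  rw [← Finset.sum_range_add_sum_Ico _ hiN]
  rw [Finset.sum_eq_zero (s := Finset.range i) (fun k hk ↦ by
    rw [if_neg (by have := Finset.mem_range.1 hk; omega)]), zero_add]
  rw [Finset.sum_Ico_eq_sum_range]
  -- now both sides are sums over `m ∈ range (N - i)`, `k = i + m`; pad the right side
  have hsplit : Finset.range N = Finset.range (N - i) ∪ Finset.Ico (N - i) N := by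
    simp only [Finset.range_eq_Ico]
    exact (Finset.Ico_union_Ico_eq_Ico (Nat.zero_le _) (Nat.sub_le _ _)).symm
  rw [hsplit, Finset.sum_union (by
    simp only [Finset.range_eq_Ico]; exact Finset.Ico_disjoint_Ico_consecutive _ _ _)]
  rw [Finset.sum_eq_zero (s := Finset.Ico (N - i) N) (fun m hm ↦ by
    have hm' : p.natDegree < m + i := by have := (Finset.mem_Ico.1 hm).1; omega
    rw [coeff_iterate_derivative, coeff_eq_zero_of_natDegree_lt hm']; simp), add_zero]
  refine Finset.sum_congr rfl fun m _ ↦ ?_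
  rw [if_pos (Nat.le_add_right i m), Nat.add_sub_cancel_left, coeff_iterate_derivative, nsmul_eq_mul,
    Nat.descFactorial_eq_factorial_mul_choose, add_comm i m]
  have hi0 : (i ! : ℂ) ≠ 0 := by exact_mod_cast i.factorial_ne_zero
  push_cast
  field_simp
  ring

/-! ### The polynomial `G(y) = Q(½ − y)` -/

/-- `G = Q ∘ (½ − X)`: the polynomial with `η = G(L⁻¹ d/ds) ξ`, i.e. `gₙ = Gₙ` in Conrey's
`η(s) = Σₙ gₙ L⁻ⁿ ξ⁽ⁿ⁾(s)` when `V = Q(−L⁻¹ d/ds)ζ` ((18), (26)–(27): "`Q(−x) = G(x + ½)`").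
[cite: Conrey1989, §3 (18), (27)] -/
def conrey89G (Q : ℝ[X]) : ℝ[X] := Q.comp (C (1 / 2) - X)

/-- `G(½ − x) = Q(x)`. [folklore] -/
theorem conrey89G_comp_half_sub (Q : ℝ[X]) : (conrey89G Q).comp (C (1 / 2) - X) = Q := by
  rw [conrey89G, comp_assoc, sub_comp, C_comp, X_comp, sub_sub_cancel, comp_X]

/-- `G(x + ½) = Q(−x)`. [folklore] -/
theorem conrey89G_comp_X_add_half (Q : ℝ[X]) : (conrey89G Q).comp (X + C (1 / 2)) = Q.comp (-X) := by
  rw [conrey89G, comp_assoc, sub_comp, C_comp, X_comp]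
  congr 1; ring

/-- The parity condition: `Q(x) + Q(1 − x) = c` is `G(y) + G(−y) = c` (`G − G(0)` is odd; Conrey's
"`g₂ₙ` imaginary, `g₂ₙ₊₁` real", (29)). [cite: Conrey1989, §3 (29)] -/
theorem conrey89G_add_comp_neg_X {Q : ℝ[X]} {c : ℝ} (hQ : Q + Q.comp (1 - X) = C c) :
    conrey89G Q + (conrey89G Q).comp (-X) = C c := by
  have h1 : (conrey89G Q).comp (-X) = Q.comp (C (1 / 2) + X) := by
    rw [conrey89G, comp_assoc, sub_comp, C_comp, X_comp, sub_neg_eq_add]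
  have h2 : (Q.comp (1 - X)).comp (C (1 / 2) - X) = Q.comp (C (1 / 2) + X) := by
    rw [comp_assoc, sub_comp, one_comp, X_comp]
    congr 1
    have e : (C 1 : ℝ[X]) - C (1 / 2) = C (1 / 2) := by rw [← C_sub]; norm_num
    rw [← C_1]
    linear_combination e
  have h3 := congrArg (fun p ↦ p.comp (C (1 / 2) - X)) hQ
  simp only [add_comp, C_comp, h2] at h3
  rw [h1, conrey89G]
  exact h3

/-! ### Conrey's `V`, `η`, `H`, `F₁` -/

/-- **Conrey's `V(s) = Q(−L⁻¹ d/ds) ζ(s)`** ("A useful approximation to `F₁(s)` … is given by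
`V(s) = Q(−(1/L) d/ds) ζ(s)`"), for a real polynomial `Q` and `L = log T`:
`conrey89V Q L s = Σₖ Qₖ (−L⁻¹)ᵏ ζ⁽ᵏ⁾(s)` (`Literature.Analysis.Complex.polyDerivOp`). For `σ > 1`,
`V(s) = Σₙ Q(log n/L)… `; it is the function whose mollified mean square Conrey's Theorem 2
evaluates. [cite: Conrey1989, §3 (26)] -/
def conrey89V (Q : ℝ[X]) (L : ℝ) (s : ℂ) : ℂ := polyDerivOp Q (-L⁻¹) riemannZeta s

/-- **Conrey's `η(s) = Σₙ gₙ L⁻ⁿ ξ⁽ⁿ⁾(s)`** with `Σ gₙ yⁿ = G(y) = Q(½ − y)`: `η = G(L⁻¹ d/ds) ξ`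
(`ξ =` `Literature.NumberTheory.LFunctions.riemannXi`, entire). On the critical line
`Re η = g ξ` (`g = G(0) = Q(½) = c/2`), so the critical zeros of `ζ` are the zeros of `Re η`.
[cite: Conrey1989, §3 (18)–(19)] -/
def conrey89Eta (Q : ℝ[X]) (L : ℝ) (s : ℂ) : ℂ := polyDerivOp (conrey89G Q) L⁻¹ riemannXi s

/-- **Conrey's `H(s) = ½ s(s − 1) π^{−s/2} Γ(s/2)`**, the factor with `ξ = H ζ`
(`= ½ s(s−1) Γℝ(s)` with Mathlib's `Complex.Gammaℝ`). [cite: Conrey1989, §2 (3)–(4)] -/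
def conrey89H (s : ℂ) : ℂ := s * (s - 1) / 2 * Gammaℝ s

/-- **Conrey's `F₁ = η/H`**: `η = H · F₁`,
`F₁(s) = gζ(s) + Σₙ gₙ L⁻ⁿ Σₖ (n choose k) (H⁽ⁿ⁻ᵏ⁾/H)(s) ζ⁽ᵏ⁾(s)` — the exact function whose
zeros off the line are counted in Levinson's method, approximated by `V`. [cite: Conrey1989, §3 (22)] -/
def conrey89F (Q : ℝ[X]) (L : ℝ) (s : ℂ) : ℂ := conrey89Eta Q L s / conrey89H s

/-- The auxiliary functions `Wᵢ = G⁽ⁱ⁾(L⁻¹ d/ds) ζ` (`G⁽ⁱ⁾` the `i`-th derivative of the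
polynomial `G`), in terms of which `F₁ = Σᵢ (L⁻ⁱ H⁽ⁱ⁾/(i! H)) Wᵢ` and `V = Σᵢ (2⁻ⁱ/i!) Wᵢ`.
[cite: Conrey1989, §3 (22)–(28)] -/
def conrey89W (Q : ℝ[X]) (L : ℝ) (i : ℕ) (s : ℂ) : ℂ :=
  polyDerivOp (derivative^[i] (conrey89G Q)) L⁻¹ riemannZeta s

/-! ### The reflection identity `η + η♯ = c ξ` and `Γℝ F₁ + (Γℝ F₁)♯ = c Γℝ ζ` -/

/-- `ξ♯ = ξ`: `conj ξ(1 − s̄) = ξ(s)` (functional equation and reality of `ξ`). [cite: Titchmarsh1986, §2.1] -/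
theorem conj_riemannXi_one_sub_conj (s : ℂ) : conj (riemannXi (1 - conj s)) = riemannXi s := by
  rw [one_sub_conj_eq, riemannXi_conj_holds, Complex.conj_conj, riemannXi_one_sub]

/-- `η` is entire. [folklore] -/
theorem differentiable_conrey89Eta (Q : ℝ[X]) (L : ℝ) : Differentiable ℂ (conrey89Eta Q L) :=
  differentiable_polyDerivOp _ _ differentiable_riemannXi

/-- **`η + η♯ = c ξ`** (everywhere): with `Q(x) + Q(1−x) = c`,
`η(s) + conj η(1 − s̄) = c ξ(s)`; on the critical line this is Conrey's "`Re η(½+it) = g ξ(½+it)`"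
(`2g = c`). [cite: Conrey1989, §3 (19), (29)] -/
theorem conrey89Eta_add_conj {Q : ℝ[X]} {c : ℝ} (hQ : Q + Q.comp (1 - X) = C c) (L : ℝ) (s : ℂ) :
    conrey89Eta Q L s + conj (conrey89Eta Q L (1 - conj s)) = c * riemannXi s := by
  have h1 : conj (conrey89Eta Q L (1 - conj s)) = polyDerivOp ((conrey89G Q).comp (-X)) L⁻¹ riemannXi s := by
    rw [conrey89Eta, conj_polyDerivOp_one_sub_conj _ _ differentiable_riemannXi s, ← polyDerivOp_neg]
    congr 1
    funext w
    exact conj_riemannXi_one_sub_conj w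
  rw [h1, conrey89Eta, ← polyDerivOp_add, conrey89G_add_comp_neg_X hQ, polyDerivOp_C]

/-- `ξ = H ζ` on `Re s > 0`, `s ≠ 1`. [cite: Titchmarsh1986, §2.1 (2.1.12)] -/
theorem riemannXi_eq_conrey89H_mul {s : ℂ} (hs : 0 < s.re) (hs1 : s ≠ 1) :
    riemannXi s = conrey89H s * riemannZeta s := by
  have h0 : s ≠ 0 := fun h ↦ by simp [h] at hs
  have hG : Gammaℝ s ≠ 0 := Gammaℝ_ne_zero_of_re_pos hs
  have hΛ : completedRiemannZeta s = Gammaℝ s * riemannZeta s := by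
    rw [riemannZeta_def_of_ne_zero h0, mul_div_cancel₀ _ hG]
  rw [riemannXi_eq_mul_completedRiemannZeta h0 hs1, hΛ, conrey89H]; ring

/-- `H(s) ≠ 0` for `Re s > 0`, `s ≠ 1`. [folklore] -/
theorem conrey89H_ne_zero {s : ℂ} (hs : 0 < s.re) (hs1 : s ≠ 1) : conrey89H s ≠ 0 := by
  have h0 : s ≠ 0 := fun h ↦ by simp [h] at hs
  have h1 : s - 1 ≠ 0 := sub_ne_zero.2 hs1
  simp only [conrey89H]
  exact mul_ne_zero (div_ne_zero (mul_ne_zero h0 h1) two_ne_zero) (Gammaℝ_ne_zero_of_re_pos hs)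

/-- `Γℝ F₁ = η/(½ s(s−1))` on `Re s > 0`, `s ≠ 1`. [folklore] -/
theorem Gammaℝ_mul_conrey89F (Q : ℝ[X]) (L : ℝ) {s : ℂ} (hs : 0 < s.re) (hs1 : s ≠ 1) :
    Gammaℝ s * conrey89F Q L s = conrey89Eta Q L s / (s * (s - 1) / 2) := by
  have h0 : s ≠ 0 := fun h ↦ by simp [h] at hs
  have h1 : s - 1 ≠ 0 := sub_ne_zero.2 hs1
  have hG : Gammaℝ s ≠ 0 := Gammaℝ_ne_zero_of_re_pos hs
  rw [conrey89F, conrey89H]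
  field_simp

/-- **`Γℝ F₁ + (Γℝ F₁)♯ = c Γℝ ζ`** on `0 < Re s < 1`: the zero detector of Levinson's method in
Conrey's 1989 form satisfies the same identity as Conrey's 1983 `Q = Γℝ·V`
(`Literature.NumberTheory.LFunctions.conreyQ_add_conj_one_sub_conj_eq`), so the generic detection
`Literature.NumberTheory.LFunctions.levinsonConrey_zeroDetection_Gammaℝ_mul` applies to `V := F₁ = conrey89F Q L`.
[cite: Conrey1989, §3 (19)–(22)] -/
theorem Gammaℝ_mul_conrey89F_add_conj {Q : ℝ[X]} {c : ℝ} (hQ : Q + Q.comp (1 - X) = C c) (L : ℝ) {s : ℂ}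
    (hs : 0 < s.re) (hs' : s.re < 1) (hs1 : s ≠ 1) :
    Gammaℝ s * conrey89F Q L s + conj (Gammaℝ (1 - conj s) * conrey89F Q L (1 - conj s)) =
      c * Gammaℝ s * riemannZeta s := by
  have h0 : s ≠ 0 := fun h ↦ by simp [h] at hs
  have h1 : s - 1 ≠ 0 := sub_ne_zero.2 hs1
  have hw : 0 < (1 - conj s).re := by simp; linarith
  have hw1 : 1 - conj s ≠ 1 := by
    intro h
    have : conj s = 0 := by linear_combination -h
    exact h0 (by simpa using congrArg conj this)
  rw [Gammaℝ_mul_conrey89F Q L hs hs1, Gammaℝ_mul_conrey89F Q L hw hw1, map_div₀]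
  have hden : conj ((1 - conj s) * (1 - conj s - 1) / 2) = s * (s - 1) / 2 := by
    simp only [map_div₀, map_mul, map_sub, map_one, Complex.conj_conj, map_ofNat]
    ring
  rw [hden, ← add_div, conrey89Eta_add_conj hQ, riemannXi_eq_conrey89H_mul hs hs1, conrey89H]
  field_simp

/-! ### Analyticity -/

/-- `F₁ = η · Γℝ⁻¹ · 2/(s(s−1))`. [folklore] -/
theorem conrey89F_eq (Q : ℝ[X]) (L : ℝ) (s : ℂ) :
    conrey89F Q L s = conrey89Eta Q L s * (Gammaℝ s)⁻¹ * (2 / (s * (s - 1))) := by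
  rw [conrey89F, conrey89H, div_eq_mul_inv, mul_inv, inv_div, mul_assoc, mul_comm (2 / (s * (s - 1)))]

/-- `F₁` is analytic away from `s = 0, 1` (`Γℝ⁻¹` is entire). [folklore] -/
theorem analyticAt_conrey89F (Q : ℝ[X]) (L : ℝ) {s : ℂ} (h0 : s ≠ 0) (h1 : s ≠ 1) :
    AnalyticAt ℂ (conrey89F Q L) s := by
  have e : conrey89F Q L = fun s ↦ conrey89Eta Q L s * (Gammaℝ s)⁻¹ * (2 / (s * (s - 1))) := funext (conrey89F_eq Q L)
  rw [e]
  refine (((differentiable_conrey89Eta Q L).analyticAt s).mul (differentiable_Gammaℝ_inv.analyticAt s)).mul ?_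
  refine analyticAt_const.div ((analyticAt_id.mul (analyticAt_id.sub analyticAt_const))) ?_
  exact mul_ne_zero h0 (sub_ne_zero.2 h1)

/-- `F₁` is analytic off the real axis. [folklore] -/
theorem analyticAt_conrey89F_of_im_ne_zero (Q : ℝ[X]) (L : ℝ) {s : ℂ} (hs : s.im ≠ 0) :
    AnalyticAt ℂ (conrey89F Q L) s :=
  analyticAt_conrey89F Q L (fun h ↦ hs (by simp [h])) (fun h ↦ hs (by simp [h]))

/-- `W_i` is analytic away from `s = 1`. [folklore] -/
theorem analyticAt_conrey89W (Q : ℝ[X]) (L : ℝ) (i : ℕ) {s : ℂ} (h1 : s ≠ 1) : AnalyticAt ℂ (conrey89W Q L i) s := by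
  unfold conrey89W
  have e : polyDerivOp (derivative^[i] (conrey89G Q)) L⁻¹ riemannZeta = fun s ↦
      ∑ k ∈ (derivative^[i] (conrey89G Q)).support, ((derivative^[i] (conrey89G Q)).coeff k : ℂ) *
        (L⁻¹ : ℝ) ^ k * iteratedDeriv k riemannZeta s := funext fun s ↦ polyDerivOp_def _ _ _ s
  rw [e]
  refine Finset.analyticAt_fun_sum _ fun k _ ↦ analyticAt_const.mul ?_
  rw [iteratedDeriv_eq_iterate]
  exact (analyticOn_riemannZeta s h1).iterated_deriv k

/-- `H` is analytic on `Re s > 0`. [folklore] -/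
theorem analyticAt_conrey89H {s : ℂ} (hs : 0 < s.re) : AnalyticAt ℂ conrey89H s := by
  unfold conrey89H
  exact ((analyticAt_id.mul (analyticAt_id.sub analyticAt_const)).div analyticAt_const two_ne_zero).mul
    (analyticAt_Gammaℝ_of_re_pos hs)

/-! ### The decompositions `V = Σᵢ (2⁻ⁱ/i!) Wᵢ` and `F₁ = Σᵢ (L⁻ⁱ H⁽ⁱ⁾/(i! H)) Wᵢ` -/

/-- `polyDerivOp` depends only on the germ of the function. [folklore] -/
theorem polyDerivOp_congr_of_eventuallyEq (p : ℝ[X]) (a : ℝ) {F G : ℂ → ℂ} {s : ℂ}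
    (h : F =ᶠ[𝓝 s] G) : polyDerivOp p a F s = polyDerivOp p a G s := by
  rw [polyDerivOp_def, polyDerivOp_def]
  exact Finset.sum_congr rfl fun k _ ↦ by rw [h.iteratedDeriv_eq k]

/-- **`V = Σᵢ (2⁻ⁱ/i!) Wᵢ`** (everywhere): `Q(−L⁻¹δ) = G(½ + L⁻¹δ) = Σᵢ (2⁻ⁱ/i!) G⁽ⁱ⁾(L⁻¹δ)` by
Taylor's formula for the polynomial `G`. [cite: Conrey1989, §3 (26)–(28)] -/
theorem conrey89V_eq_sum (Q : ℝ[X]) (L : ℝ) (s : ℂ) :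
    conrey89V Q L s = ∑ i ∈ Finset.range ((conrey89G Q).natDegree + 1),
      ((1 / 2 : ℂ) ^ i / (i ! : ℂ)) * conrey89W Q L i s := by
  rw [conrey89V, polyDerivOp_neg, ← conrey89G_comp_X_add_half,
    comp_X_add_C_eq_sum_derivative (conrey89G Q) (1 / 2) (Nat.lt_succ_self _), polyDerivOp_finset_sum_left]
  refine Finset.sum_congr rfl fun i _ ↦ ?_
  rw [polyDerivOp_C_mul, conrey89W]
  push_cast
  ring

/-- **`η = Σᵢ (L⁻ⁱ/i!) H⁽ⁱ⁾ Wᵢ`** on `Re s > 0`, `s ≠ 1` (Leibniz's rule for `G(L⁻¹δ)(H ζ)`).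
[cite: Conrey1989, §3 (22)] -/
theorem conrey89Eta_eq_sum (Q : ℝ[X]) (L : ℝ) {s : ℂ} (hs : 0 < s.re) (hs1 : s ≠ 1) :
    conrey89Eta Q L s = ∑ i ∈ Finset.range ((conrey89G Q).natDegree + 1),
      ((L⁻¹ : ℝ) : ℂ) ^ i / (i ! : ℂ) * iteratedDeriv i conrey89H s * conrey89W Q L i s := by
  -- `ξ = H ζ` near `s`
  have hU : IsOpen {w : ℂ | 0 < w.re ∧ w ≠ 1} :=
    (isOpen_lt continuous_const continuous_re).inter isOpen_ne
  have hev : riemannXi =ᶠ[𝓝 s] (conrey89H * riemannZeta) := by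
    filter_upwards [hU.mem_nhds ⟨hs, hs1⟩] with w hw
    exact riemannXi_eq_conrey89H_mul hw.1 hw.2
  rw [conrey89Eta, polyDerivOp_congr_of_eventuallyEq _ _ hev]
  have hH : ∀ n : ℕ, ContDiffAt ℂ n conrey89H s := fun n ↦ (analyticAt_conrey89H hs).contDiffAt
  have hZ : ∀ n : ℕ, ContDiffAt ℂ n riemannZeta s := fun n ↦ (analyticOn_riemannZeta s hs1).contDiffAt
  rw [polyDerivOp_mul_eq_sum (conrey89G Q) L⁻¹ hH hZ (Nat.lt_succ_self _)]
  rfl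

/-- **`F₁ = Σᵢ (L⁻ⁱ/i!) (H⁽ⁱ⁾/H) Wᵢ`** on `Re s > 0`, `s ≠ 1`: Conrey's
`F₁(s) = gζ(s) + Σₙ gₙ L⁻ⁿ Σₖ (n choose k) (H⁽ⁿ⁻ᵏ⁾/H)(s) ζ⁽ᵏ⁾(s)`, grouped by the order of the
derivative of `H`. [cite: Conrey1989, §3 (22)] -/
theorem conrey89F_eq_sum (Q : ℝ[X]) (L : ℝ) {s : ℂ} (hs : 0 < s.re) (hs1 : s ≠ 1) :
    conrey89F Q L s = ∑ i ∈ Finset.range ((conrey89G Q).natDegree + 1),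
      ((L⁻¹ : ℝ) : ℂ) ^ i / (i ! : ℂ) * (iteratedDeriv i conrey89H s / conrey89H s) * conrey89W Q L i s := by
  rw [conrey89F, conrey89Eta_eq_sum Q L hs hs1, Finset.sum_div]
  refine Finset.sum_congr rfl fun i _ ↦ ?_
  have h := conrey89H_ne_zero hs hs1
  field_simp

/-- **`F₁ − V = Σᵢ eᵢ Wᵢ`**, `eᵢ = (L⁻ⁱ H⁽ⁱ⁾/H − 2⁻ⁱ)/i!` (the term `i = 0` vanishes), on `Re s > 0`,
`s ≠ 1`. With `H'/H(s) = ½ log(t/2π) + O(1/|t|)` (Conrey's (23)) each `eᵢ` is `O(1/L)` for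
`t ≍ T = e^L`: this is the sense in which "`V` is a useful approximation to `F₁`".
[cite: Conrey1989, §3 (23)–(31)] -/
theorem conrey89F_sub_conrey89V (Q : ℝ[X]) (L : ℝ) {s : ℂ} (hs : 0 < s.re) (hs1 : s ≠ 1) :
    conrey89F Q L s - conrey89V Q L s = ∑ i ∈ Finset.range ((conrey89G Q).natDegree + 1),
      (((L⁻¹ : ℝ) : ℂ) ^ i * (iteratedDeriv i conrey89H s / conrey89H s) - (1 / 2 : ℂ) ^ i) / (i ! : ℂ) *
        conrey89W Q L i s := by
  rw [conrey89F_eq_sum Q L hs hs1, conrey89V_eq_sum, ← Finset.sum_sub_distrib]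
  refine Finset.sum_congr rfl fun i _ ↦ ?_
  ring

/-- The coefficient `e₀` vanishes: `L⁰ H⁽⁰⁾/H − 2⁰ = 0`. [folklore] -/
theorem coeff_zero_conrey89F_sub_conrey89V {s : ℂ} (hs : 0 < s.re) (hs1 : s ≠ 1) (L : ℝ) :
    ((L⁻¹ : ℝ) : ℂ) ^ 0 * (iteratedDeriv 0 conrey89H s / conrey89H s) - (1 / 2 : ℂ) ^ 0 = 0 := by
  rw [iteratedDeriv_zero, div_self (conrey89H_ne_zero hs hs1)]; simp

end Literature.NumberTheory.LFunctions
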